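/-
Copyright (c) 2026 the pub-hodgecm-mathlib formalisation cell (harness21).  Prover seat hodgecm-mathlib-K2E5-p17 (g10), Track B ∕ K2-LIT, h413 = `stmt-HodgeConjecture-24833`,
R90-TF section S8 «ContSpec-n½ ∕ ResidualSpectrum», socket (E) `B :276`, S8 dealer R90-CS-plan (g4) S8-R256 (3) «GO AS OFFERED `R90S8ResGBlockCoverOfTransversalU3` (COVER_β: member half
letter-free; associate half hypothesis-first on the ONE [MW II.2.1] letter)» — the sequel of ★ p865138 `R90S8ResHeadLevelOfNiceCoreU3`.
-/
import Summits.HodgeConjecture.HodgeConjecture.Theorems.R90S8ResHeadLevelOfNiceCoreU3     -- ★ p865138 (this seat): `hHead_level_of_niceCoreAll_of_cover` ((HEAD₃) ⟸ GEN₃^X + COVER_β); brings ★ G-DEFS `resGBlock`, ★ `reflectChar`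
import HarnessLib

/-!
# S8 (E) `B :276` — `R90S8ResGBlockCoverOfTransversalU3`: THE COVER LETTER COVER_β OF ★ `hHead_level_of_niceCoreAll_of_cover` FROM A TRANSVERSAL WITNESS — member half
# letter-free, associate half hypothesis-first on ONE named [MW II.2.1] letter «`Sc(K′, ω; χ₁ʷ, χ₂) ≤ Sc(K′, ω; χ₁, χ₂)`»; and (HEAD₃) re-assembled on {GEN₃^X, WITNESS_β, ASSOC}

Track B ∕ K2-LIT, crux h413 = `stmt-HodgeConjecture-24833`, route of record `HCCMUnconditional`; cell `hodgecm-mathlib`, R90-TF programme, section S8.  THEOREMS ONLY (no `def`, no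
`instance`, no notation, no named-fact hypothesis, no `sorry`; default heartbeats); lane `--kind proof --supports stmt-HodgeConjecture-24833 --as helper` (count-neutral); imports ★
`Theorems/` only.  CLOSES NO SOCKET.

WHERE THIS SITS.  After ★ p865138 the (E) column reads: (E) :276 = ★ p863837 ∘ ★ p863683 with `hHead_level := hHead_level_of_niceCoreAll_of_cover … hall hcov` MODULO {GEN₃^X = `hall`
(the N = 3 nice-class generator core over a per-level pair family `X Kf`, census (m1)–(m5)), COVER_β = `hcov` (`∀ Kf x, resGBlock L μ (ι_f Kf) 1 (η₁ Kf x) (η₂ Kf x) ≤ cl ⨆_b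
resGBlock L μ (ι_f Kf) 1 (χ₁ b) (χ₂ b)`)}.  The consumer's family `b ↦ (χ₁ b, χ₂ b)` is a TRANSVERSAL of the Borel data up to association (★ p863683's `hT`: no two members satisfy
`(χ₁ b′ = χ₁ b ∧ χ₂ b′ = χ₂ b) ∨ (χ₁ b′ = (χ₁ b)ʷ ∧ χ₂ b′ = χ₂ b)`, `χʷ := reflectChar c χ`, ★ `K2E1CharacterEisensteinU2Defs.reflectChar`, [MW II.1.7]).  So COVER_β splits into
(i) a TRANSVERSAL WITNESS — every pair `(η₁ Kf x, η₂ Kf x)` of the generating family IS a member `(χ₁ b, χ₂ b)` or the associate `((χ₁ b)ʷ, χ₂ b)` of a member — which is how the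
payer of `B :276` CHOOSES `β` (bookkeeping, no analysis), and (ii) THE ONE ANALYTIC LETTER [MoeglinWaldspurger1995, II.2.1 with II.1.7]: «ASSOCIATE BOREL DATA HAVE THE SAME
BLOCK» in the `≤` form the cover needs — `ASSOC : resGBlock L μ K′ ω (χ₁ʷ) χ₂ ≤ resGBlock L μ K′ ω χ₁ χ₂` (the pseudo-Eisenstein wave packets of the reflected datum lie in the closed span
of those of the datum: functional equation `E(φ, z) = E(M(z)φ, −z)` of the Borel Eisenstein series + the closedness of the block; OPEN, NAMED, owner: the E1 intertwining estate
★ `K2E1ChiScatteringPoleDichotomyU3` ∕ `HasReflectedIntertwining` currency).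
* §0 generic closure algebra: `le_topologicalClosure_iSup_of_le` (`S ≤ A b ⇒ S ≤ cl ⨆ A`).
* §1 **`resGBlock_le_topologicalClosure_iSup_of_member`** (MEMBER HALF, letter-free) and **`resGBlock_le_topologicalClosure_iSup_of_associate`** (ASSOCIATE HALF, hypothesis-first on
  `ASSOC` at the member `b`), any level datum `(K′, ω)`.
* §2 **`cover_of_transversal`** — COVER_β at any `(K′, ω)`: WITNESS (`hmem`, the `hT`-shaped disjunction) + `ASSOC` at the members hit ⟹ `∀ x, resGBlock … (η₁ x) (η₂ x) ≤ cl ⨆_b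
  resGBlock … (χ₁ b) (χ₂ b)`; **`hcov_of_transversal`** = the same in ★ p865138's `hcov` bytes (`K′ := Kf.1.map ι_f`, `ω := 1`, per-level index `X Kf`).
* §3 **`hHead_level_of_niceCoreAll_of_transversal`** — (HEAD₃) `hHead_level` (★ p863683 :179 ∕ ★ p863837 :98 BYTES) ⟸ {GEN₃^X `hall`, WITNESS_β `hmem`, ASSOC `hassoc`} + the Borel
  guards, by ★ `hHead_level_of_niceCoreAll_of_cover` ∘ §2.
NET EFFECT ON THE (E) COLUMN: COVER_β is PAID modulo the single named letter ASSOC (S–M, analytic) and the payer's choice of transversal (WITNESS_β, bookkeeping); (HEAD₃) = ★ modulo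
{GEN₃^X (L), ASSOC (S–M)}.
HONEST LABEL: pays no socket and no printed citation; GEN₃^X and ASSOC stay OPEN and NAMED; HC_CM is proved only modulo the 7 printed citations (2 remaining named inputs: hLiu418 =
`stmt-HodgeConjecture-24832`, h413 = `stmt-HodgeConjecture-24833`) until rung 0 closes; REL ≠ ★ ≠ BUILT; count-neutral.

## References
* [MoeglinWaldspurger1995] C. Mœglin, J.-L. Waldspurger, *Spectral Decomposition and Eisenstein Series* (Cambridge Tracts 113, 1995), II.1.7 (`χʷ`, `M(w, π)`), II.2.1 (inner product of
  pseudo-Eisenstein series; associate data), II.2.4 (decomposition along cuspidal data).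
* [Langlands1976] R. P. Langlands, *On the Functional Equations Satisfied by Eisenstein Series*, LNM 544 (1976), §7.
* [DeitmarEchterhoff2014] A. Deitmar, S. Echterhoff, *Principles of Harmonic Analysis* (2nd ed., 2014), Lemma 7.2.6 (closed spans).
-/

set_option autoImplicit false
set_option linter.dupNamespace false  -- the mandated namespace `…HodgeConjecture.HodgeConjecture.R90.S8` (LEAD #1 L1) repeats the summit's segment

noncomputable section

open MeasureTheory Measure Set Filter Topology NumberField
open Literature.MeasureTheory.Group Literature.NumberTheory Literature.NumberTheory.Automorphic Literature.NumberTheory.Automorphic.UnitaryGroup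
open Literature.NumberTheory.GaloisRepresentations AdelicGroupData ContRepresentation
open Literature.NumberTheory.Automorphic.Arthur2013.Leaves.TECR
open Summit.HodgeConjecture.HodgeConjecture.Cruxes.H413.K2E1CharacterEisensteinU2Defs (reflectChar)
open scoped ENNReal NNReal Pointwise

namespace Summit.HodgeConjecture.HodgeConjecture.R90.S8

/-! ## §0 Closure algebra (generic) -/

section Generic

variable {M : Type*} [AddCommGroup M] [Module ℂ M] [TopologicalSpace M] [ContinuousAdd M] [ContinuousConstSMul ℂ M]

/-- **`S ≤ A b ⇒ S ≤ cl ⨆_b A b`**. [cite: DeitmarEchterhoff2014, Lemma 7.2.6] -/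
theorem le_topologicalClosure_iSup_of_le {ι : Sort*} (A : ι → Submodule ℂ M) {S : Submodule ℂ M} (b : ι) (h : S ≤ A b) :
    S ≤ (⨆ b, A b).topologicalClosure :=
  (h.trans (le_iSup A b)).trans (Submodule.le_topologicalClosure _)

end Generic

/-! ## §1 The two halves of the cover at one block, any level datum `(K′, ω)` -/

section Halves

variable (L : Type) [Field L] [NumberField L] [IsCMField L]
  (μ : Measure (quasiSplit (↥(maximalRealSubfield L)) L (IsCMField.complexConj L) 3).automorphicQuotient)
  (K' : Subgroup (quasiSplit (↥(maximalRealSubfield L)) L (IsCMField.complexConj L) 3).Adelic) (ω : ↥K' →* ℂ)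

/-- **MEMBER HALF (letter-free)**: a block of the generating family that IS a member `(χ₁ b, χ₂ b)` of the consumer's family lies in `cl ⨆_b resGBlock L μ K′ ω (χ₁ b) (χ₂ b)`
(`le_iSup` + `le_topologicalClosure`). [cite: MoeglinWaldspurger1995, II.2.4] -/
theorem resGBlock_le_topologicalClosure_iSup_of_member {β : Type*} (χ₁ : β → HeckeCharacter L) (χ₂ : β → (↥(TorusDict.torus (IsCMField.complexConj L)) →ₜ* ℂˣ))
    {η₁ : HeckeCharacter L} {η₂ : (↥(TorusDict.torus (IsCMField.complexConj L)) →ₜ* ℂˣ)} (b : β) (h₁ : η₁ = χ₁ b) (h₂ : η₂ = χ₂ b) :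
    resGBlock L μ K' ω η₁ η₂ ≤ (⨆ b, resGBlock L μ K' ω (χ₁ b) (χ₂ b)).topologicalClosure := by
  subst h₁ h₂
  exact le_topologicalClosure_iSup_of_le (fun b => resGBlock L μ K' ω (χ₁ b) (χ₂ b)) b le_rfl

/-- **ASSOCIATE HALF (hypothesis-first on ASSOC at the member hit)**: a block of the generating family that is the ASSOCIATE `((χ₁ b)ʷ, χ₂ b)` of a member lies in
`cl ⨆_b resGBlock L μ K′ ω (χ₁ b) (χ₂ b)` PROVIDED «associate Borel data have the same block» in the `≤` form at that member:
`hassoc : resGBlock L μ K′ ω (reflectChar c (χ₁ b)) (χ₂ b) ≤ resGBlock L μ K′ ω (χ₁ b) (χ₂ b)` — THE [MW II.2.1] letter (functional equation of the Borel Eisenstein series ∕ the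
reflected intertwining; OPEN, NAMED). [cite: MoeglinWaldspurger1995, II.1.7, II.2.1] [cite: Langlands1976, §7] -/
theorem resGBlock_le_topologicalClosure_iSup_of_associate {β : Type*} (χ₁ : β → HeckeCharacter L) (χ₂ : β → (↥(TorusDict.torus (IsCMField.complexConj L)) →ₜ* ℂˣ))
    {η₁ : HeckeCharacter L} {η₂ : (↥(TorusDict.torus (IsCMField.complexConj L)) →ₜ* ℂˣ)} (b : β) (h₁ : η₁ = reflectChar (IsCMField.complexConj L) (χ₁ b)) (h₂ : η₂ = χ₂ b)
    (hassoc : resGBlock L μ K' ω (reflectChar (IsCMField.complexConj L) (χ₁ b)) (χ₂ b) ≤ resGBlock L μ K' ω (χ₁ b) (χ₂ b)) :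
    resGBlock L μ K' ω η₁ η₂ ≤ (⨆ b, resGBlock L μ K' ω (χ₁ b) (χ₂ b)).topologicalClosure := by
  subst h₁ h₂
  exact le_topologicalClosure_iSup_of_le (fun b => resGBlock L μ K' ω (χ₁ b) (χ₂ b)) b hassoc

end Halves

/-! ## §2 COVER_β from a transversal witness and ASSOC -/

section Cover

variable (L : Type) [Field L] [NumberField L] [IsCMField L]
  (μ : Measure (quasiSplit (↥(maximalRealSubfield L)) L (IsCMField.complexConj L) 3).automorphicQuotient)

/-- **THE COVER AT ANY LEVEL DATUM `(K′, ω)`**: if every pair `(η₁ x, η₂ x)` of the generating family is a member of the consumer's family or the associate of a member (`hmem`, the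
`hT`-shaped disjunction of ★ `res_exhaustion_le_closure_of_letters` — the TRANSVERSAL WITNESS), and ASSOC holds at every member (`hassoc`), then every generating block lies in
`cl ⨆_b resGBlock L μ K′ ω (χ₁ b) (χ₂ b)` (§1, case by case). [cite: MoeglinWaldspurger1995, II.2.1, II.2.4] -/
theorem cover_of_transversal (K' : Subgroup (quasiSplit (↥(maximalRealSubfield L)) L (IsCMField.complexConj L) 3).Adelic) (ω : ↥K' →* ℂ)
    {β : Type*} (χ₁ : β → HeckeCharacter L) (χ₂ : β → (↥(TorusDict.torus (IsCMField.complexConj L)) →ₜ* ℂˣ))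
    {X : Type*} (η₁ : X → HeckeCharacter L) (η₂ : X → (↥(TorusDict.torus (IsCMField.complexConj L)) →ₜ* ℂˣ))
    (hmem : ∀ x : X, ∃ b : β, (η₁ x = χ₁ b ∧ η₂ x = χ₂ b) ∨ (η₁ x = reflectChar (IsCMField.complexConj L) (χ₁ b) ∧ η₂ x = χ₂ b))
    (hassoc : ∀ b : β, resGBlock L μ K' ω (reflectChar (IsCMField.complexConj L) (χ₁ b)) (χ₂ b) ≤ resGBlock L μ K' ω (χ₁ b) (χ₂ b)) (x : X) :
    resGBlock L μ K' ω (η₁ x) (η₂ x) ≤ (⨆ b, resGBlock L μ K' ω (χ₁ b) (χ₂ b)).topologicalClosure := by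
  obtain ⟨b, ⟨h₁, h₂⟩ | ⟨h₁, h₂⟩⟩ := hmem x
  · exact resGBlock_le_topologicalClosure_iSup_of_member L μ K' ω χ₁ χ₂ b h₁ h₂
  · exact resGBlock_le_topologicalClosure_iSup_of_associate L μ K' ω χ₁ χ₂ b h₁ h₂ (hassoc b)

/-- **COVER_β IN ★ p865138's `hcov` BYTES** (`K′ := Kf.1.map ι_f`, `ω := 1`, per-level index `X Kf`): the transversal witness at every finite level of record plus ASSOC at the
members, at every level, give the `hcov` input of ★ `hHead_level_of_niceCoreAll_of_cover` ∕ ★ `niceCore_of_cover`. [cite: MoeglinWaldspurger1995, II.2.1, II.2.4] -/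
theorem hcov_of_transversal
    {β : Type*} (χ₁ : β → HeckeCharacter L) (χ₂ : β → (↥(TorusDict.torus (IsCMField.complexConj L)) →ₜ* ℂˣ))
    {X : {Kf : Subgroup ↥(finAdelic (↥(maximalRealSubfield L)) L (IsCMField.complexConj L) 3 ((StdForm.antidiagonal 3).over L)) // IsOpen ((Kf : Subgroup ↥(finAdelic (↥(maximalRealSubfield L)) L (IsCMField.complexConj L) 3 ((StdForm.antidiagonal 3).over L))) : Set ↥(finAdelic (↥(maximalRealSubfield L)) L (IsCMField.complexConj L) 3 ((StdForm.antidiagonal 3).over L))) ∧ Kf ≤ ((((standardMaximalCompactGL 3 L).comap (adelicVal (↥(maximalRealSubfield L)) L (IsCMField.complexConj L) 3 ((StdForm.antidiagonal 3).over L)) : Subgroup (quasiSplit (↥(maximalRealSubfield L)) L (IsCMField.complexConj L) 3).Adelic)).comap (finAdelicToAdelic (↥(maximalRealSubfield L)) L (IsCMField.complexConj L) 3 ((StdForm.antidiagonal 3).over L)) : Subgroup ↥(finAdelic (↥(maximalRealSubfield L)) L (IsCMField.complexConj L) 3 ((StdForm.antidiagonal 3).over L)))} → Type*}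
    (η₁ : ∀ Kf, X Kf → HeckeCharacter L) (η₂ : ∀ Kf, X Kf → (↥(TorusDict.torus (IsCMField.complexConj L)) →ₜ* ℂˣ))
    (hmem : ∀ (Kf : {Kf : Subgroup ↥(finAdelic (↥(maximalRealSubfield L)) L (IsCMField.complexConj L) 3 ((StdForm.antidiagonal 3).over L)) // IsOpen ((Kf : Subgroup ↥(finAdelic (↥(maximalRealSubfield L)) L (IsCMField.complexConj L) 3 ((StdForm.antidiagonal 3).over L))) : Set ↥(finAdelic (↥(maximalRealSubfield L)) L (IsCMField.complexConj L) 3 ((StdForm.antidiagonal 3).over L))) ∧ Kf ≤ ((((standardMaximalCompactGL 3 L).comap (adelicVal (↥(maximalRealSubfield L)) L (IsCMField.complexConj L) 3 ((StdForm.antidiagonal 3).over L)) : Subgroup (quasiSplit (↥(maximalRealSubfield L)) L (IsCMField.complexConj L) 3).Adelic)).comap (finAdelicToAdelic (↥(maximalRealSubfield L)) L (IsCMField.complexConj L) 3 ((StdForm.antidiagonal 3).over L)) : Subgroup ↥(finAdelic (↥(maximalRealSubfield L)) L (IsCMField.complexConj L) 3 ((StdForm.antidiagonal 3).over L)))}) (x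 : X Kf),
      ∃ b : β, (η₁ Kf x = χ₁ b ∧ η₂ Kf x = χ₂ b) ∨ (η₁ Kf x = reflectChar (IsCMField.complexConj L) (χ₁ b) ∧ η₂ Kf x = χ₂ b))
    (hassoc : ∀ (Kf : {Kf : Subgroup ↥(finAdelic (↥(maximalRealSubfield L)) L (IsCMField.complexConj L) 3 ((StdForm.antidiagonal 3).over L)) // IsOpen ((Kf : Subgroup ↥(finAdelic (↥(maximalRealSubfield L)) L (IsCMField.complexConj L) 3 ((StdForm.antidiagonal 3).over L))) : Set ↥(finAdelic (↥(maximalRealSubfield L)) L (IsCMField.complexConj L) 3 ((StdForm.antidiagonal 3).over L))) ∧ Kf ≤ ((((standardMaximalCompactGL 3 L).comap (adelicVal (↥(maximalRealSubfield L)) L (IsCMField.complexConj L) 3 ((StdForm.antidiagonal 3).over L)) : Subgroup (quasiSplit (↥(maximalRealSubfield L)) L (IsCMField.complexConj L) 3).Adelic)).comap (finAdelicToAdelic (↥(maximalRealSubfield L)) L (IsCMField.complexConj L) 3 ((StdForm.antidiagonal 3).over L)) : Subgroup ↥(finAdelic (↥(maximalRealSubfield L)) L (IsCMField.complexConj L)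 3 ((StdForm.antidiagonal 3).over L)))}) (b : β),
      resGBlock L μ (Kf.1.map (finAdelicToAdelic (↥(maximalRealSubfield L)) L (IsCMField.complexConj L) 3 ((StdForm.antidiagonal 3).over L))) 1 (reflectChar (IsCMField.complexConj L) (χ₁ b)) (χ₂ b) ≤ resGBlock L μ (Kf.1.map (finAdelicToAdelic (↥(maximalRealSubfield L)) L (IsCMField.complexConj L) 3 ((StdForm.antidiagonal 3).over L))) 1 (χ₁ b) (χ₂ b))
    (Kf : {Kf : Subgroup ↥(finAdelic (↥(maximalRealSubfield L)) L (IsCMField.complexConj L) 3 ((StdForm.antidiagonal 3).over L)) // IsOpen ((Kf : Subgroup ↥(finAdelic (↥(maximalRealSubfield L)) L (IsCMField.complexConj L) 3 ((StdForm.antidiagonal 3).over L))) : Set ↥(finAdelic (↥(maximalRealSubfield L)) L (IsCMField.complexConj L) 3 ((StdForm.antidiagonal 3).over L))) ∧ Kf ≤ ((((standardMaximalCompactGL 3 L).comap (adelicVal (↥(maximalRealSubfield L)) L (IsCMField.complexConj L) 3 ((StdForm.antidiagonal 3).over L)) : Subgroup (quasiSplit (↥(maximalRealSubfield L)) L (IsCMField.complexConj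 L) 3).Adelic)).comap (finAdelicToAdelic (↥(maximalRealSubfield L)) L (IsCMField.complexConj L) 3 ((StdForm.antidiagonal 3).over L)) : Subgroup ↥(finAdelic (↥(maximalRealSubfield L)) L (IsCMField.complexConj L) 3 ((StdForm.antidiagonal 3).over L)))}) (x : X Kf) :
    resGBlock L μ (Kf.1.map (finAdelicToAdelic (↥(maximalRealSubfield L)) L (IsCMField.complexConj L) 3 ((StdForm.antidiagonal 3).over L))) 1 (η₁ Kf x) (η₂ Kf x) ≤ (⨆ b, resGBlock L μ (Kf.1.map (finAdelicToAdelic (↥(maximalRealSubfield L)) L (IsCMField.complexConj L) 3 ((StdForm.antidiagonal 3).over L))) 1 (χ₁ b) (χ₂ b)).topologicalClosure :=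
  cover_of_transversal L μ _ 1 χ₁ χ₂ (η₁ Kf) (η₂ Kf) (hmem Kf) (hassoc Kf) x

end Cover

/-! ## §3 (HEAD₃) re-assembled on {GEN₃^X, WITNESS_β, ASSOC} -/

section Head

variable (L : Type) [Field L] [NumberField L] [IsCMField L]
  (μ : Measure (quasiSplit (↥(maximalRealSubfield L)) L (IsCMField.complexConj L) 3).automorphicQuotient)

/-- **(HEAD₃) `hHead_level` FROM THE GENERATOR CORE OVER ANY PAIR FAMILY, A TRANSVERSAL WITNESS AND ASSOC** [MW II.2.4 with II.2.1]: the bytes of ★ `res_exhaustion_le_closure_of_letters`'s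
binder `hHead_level` (:179; ★ `…_of_record` :98) from `hall` (GEN₃^X: every nice left-`ι_f(Kf)`-invariant pseudo-Eisenstein class lies in `cl ⨆_x resGBlock L μ (ι_f Kf) 1 (η₁ Kf x) (η₂ Kf x)`),
`hmem` (WITNESS_β: each `(η₁ Kf x, η₂ Kf x)` is a member of the consumer's family or the associate of one) and `hassoc` (ASSOC at the members, every level) — ★
`hHead_level_of_niceCoreAll_of_cover` fed by §2.  After this file (HEAD₃) = ★ modulo {GEN₃^X (L, census (m1)–(m5)), ASSOC (S–M)} and the payer's bookkeeping `hmem`.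
[cite: MoeglinWaldspurger1995, II.2.1, II.2.4] [cite: Langlands1976, §7] -/
theorem hHead_level_of_niceCoreAll_of_transversal
    (𝔓 : (quasiSplit (↥(maximalRealSubfield L)) L (IsCMField.complexConj L) 3).ParabolicUnipotentData) (hne : Nonempty 𝔓.ι) (h𝔓 : ∀ i : 𝔓.ι, 𝔓.radical i = adelicUnipotent (↥(maximalRealSubfield L)) L (IsCMField.complexConj L) 3)
    [MeasurableSpace (quasiSplit (↥(maximalRealSubfield L)) L (IsCMField.complexConj L) 3).Adelic] [BorelSpace (quasiSplit (↥(maximalRealSubfield L)) L (IsCMField.complexConj L) 3).Adelic] [(quasiSplit (↥(maximalRealSubfield L)) L (IsCMField.complexConj L) 3).IsAutomorphicMeasure μ]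
    {β : Type*} (χ₁ : β → HeckeCharacter L) (χ₂ : β → (↥(TorusDict.torus (IsCMField.complexConj L)) →ₜ* ℂˣ))
    {X : {Kf : Subgroup ↥(finAdelic (↥(maximalRealSubfield L)) L (IsCMField.complexConj L) 3 ((StdForm.antidiagonal 3).over L)) // IsOpen ((Kf : Subgroup ↥(finAdelic (↥(maximalRealSubfield L)) L (IsCMField.complexConj L) 3 ((StdForm.antidiagonal 3).over L))) : Set ↥(finAdelic (↥(maximalRealSubfield L)) L (IsCMField.complexConj L) 3 ((StdForm.antidiagonal 3).over L))) ∧ Kf ≤ ((((standardMaximalCompactGL 3 L).comap (adelicVal (↥(maximalRealSubfield L)) L (IsCMField.complexConj L) 3 ((StdForm.antidiagonal 3).over L)) : Subgroup (quasiSplit (↥(maximalRealSubfield L)) L (IsCMField.complexConj L) 3).Adelic)).comap (finAdelicToAdelic (↥(maximalRealSubfield L)) L (IsCMField.complexConj L) 3 ((StdForm.antidiagonal 3).over L)) : Subgroup ↥(finAdelic (↥(maximalRealSubfield L)) L (IsCMField.complexConj L) 3 ((StdForm.antidiagonal 3).over L)))} → Type*}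
    (η₁ : ∀ Kf, X Kf → HeckeCharacter L) (η₂ : ∀ Kf, X Kf → (↥(TorusDict.torus (IsCMField.complexConj L)) →ₜ* ℂˣ))
    (hall : ∀ Kf : {Kf : Subgroup ↥(finAdelic (↥(maximalRealSubfield L)) L (IsCMField.complexConj L) 3 ((StdForm.antidiagonal 3).over L)) // IsOpen ((Kf : Subgroup ↥(finAdelic (↥(maximalRealSubfield L)) L (IsCMField.complexConj L) 3 ((StdForm.antidiagonal 3).over L))) : Set ↥(finAdelic (↥(maximalRealSubfield L)) L (IsCMField.complexConj L) 3 ((StdForm.antidiagonal 3).over L))) ∧ Kf ≤ ((((standardMaximalCompactGL 3 L).comap (adelicVal (↥(maximalRealSubfield L)) L (IsCMField.complexConj L) 3 ((StdForm.antidiagonal 3).over L)) : Subgroup (quasiSplit (↥(maximalRealSubfield L)) L (IsCMField.complexConj L) 3).Adelic)).comap (finAdelicToAdelic (↥(maximalRealSubfield L)) L (IsCMField.complexConj L) 3 ((StdForm.antidiagonal 3).over L)) : Subgroup ↥(finAdelic (↥(maximalRealSubfield L)) L (IsCMField.complexConj L) 3 ((StdForm.antidiagonal 3).over L)))},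
      {f : (quasiSplit (↥(maximalRealSubfield L)) L (IsCMField.complexConj L) 3).L2 μ | ∃ (i : 𝔓.ι) (Φ : (quasiSplit (↥(maximalRealSubfield L)) L (IsCMField.complexConj L) 3).Adelic → ℂ) (_ : Measurable Φ)
        (_ : ∀ (g : (quasiSplit (↥(maximalRealSubfield L)) L (IsCMField.complexConj L) 3).Adelic) (n : 𝔓.radical i), Φ (g * n) = Φ g)
        (_ : ∫⁻ x, (∑' q : (quasiSplit (↥(maximalRealSubfield L)) L (IsCMField.complexConj L) 3).quotientSubgroup ⧸ (𝔓.radical i).subgroupOf (quasiSplit (↥(maximalRealSubfield L)) L (IsCMField.complexConj L) 3).quotientSubgroup,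
          ‖Φ ((Quotient.out x : (quasiSplit (↥(maximalRealSubfield L)) L (IsCMField.complexConj L) 3).Adelic) * ((q.out : (quasiSplit (↥(maximalRealSubfield L)) L (IsCMField.complexConj L) 3).quotientSubgroup) : (quasiSplit (↥(maximalRealSubfield L)) L (IsCMField.complexConj L) 3).Adelic))‖ₑ) ^ 2 ∂μ < ∞)
        (_ : Continuous Φ) (_ : ∃ M : ℝ, ∀ g, ‖Φ g‖ ≤ M) (_ : ∃ C : Set (quasiSplit (↥(maximalRealSubfield L)) L (IsCMField.complexConj L) 3).Adelic, IsCompact C ∧ ∀ g, g ∉ C * ((𝔓.radical i : Subgroup (quasiSplit (↥(maximalRealSubfield L)) L (IsCMField.complexConj L) 3).Adelic) : Set (quasiSplit (↥(maximalRealSubfield L)) L (IsCMField.complexConj L) 3).Adelic) → Φ g = 0)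
        (_ : ∀ (u : ↥(Kf.1)) (h : (quasiSplit (↥(maximalRealSubfield L)) L (IsCMField.complexConj L) 3).Adelic), Φ (finAdelicToAdelic (↥(maximalRealSubfield L)) L (IsCMField.complexConj L) 3 ((StdForm.antidiagonal 3).over L) (u : ↥(finAdelic (↥(maximalRealSubfield L)) L (IsCMField.complexConj L) 3 ((StdForm.antidiagonal 3).over L))) * h) = Φ h)
        (hθ : MemLp (fun x : (quasiSplit (↥(maximalRealSubfield L)) L (IsCMField.complexConj L) 3).automorphicQuotient => ∑' q : (quasiSplit (↥(maximalRealSubfield L)) L (IsCMField.complexConj L) 3).quotientSubgroup ⧸ (𝔓.radical i).subgroupOf (quasiSplit (↥(maximalRealSubfield L)) L (IsCMField.complexConj L) 3).quotientSubgroup,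
          Φ ((Quotient.out x : (quasiSplit (↥(maximalRealSubfield L)) L (IsCMField.complexConj L) 3).Adelic) * ((q.out : (quasiSplit (↥(maximalRealSubfield L)) L (IsCMField.complexConj L) 3).quotientSubgroup) : (quasiSplit (↥(maximalRealSubfield L)) L (IsCMField.complexConj L) 3).Adelic))) 2 μ), f = hθ.toLp _} ⊆
        ((⨆ x : X Kf, resGBlock L μ (Kf.1.map (finAdelicToAdelic (↥(maximalRealSubfield L)) L (IsCMField.complexConj L) 3 ((StdForm.antidiagonal 3).over L))) 1 (η₁ Kf x) (η₂ Kf x)).topologicalClosure : Set ((quasiSplit (↥(maximalRealSubfield L)) L (IsCMField.complexConj L) 3).L2 μ)))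
    (hmem : ∀ (Kf : {Kf : Subgroup ↥(finAdelic (↥(maximalRealSubfield L)) L (IsCMField.complexConj L) 3 ((StdForm.antidiagonal 3).over L)) // IsOpen ((Kf : Subgroup ↥(finAdelic (↥(maximalRealSubfield L)) L (IsCMField.complexConj L) 3 ((StdForm.antidiagonal 3).over L))) : Set ↥(finAdelic (↥(maximalRealSubfield L)) L (IsCMField.complexConj L) 3 ((StdForm.antidiagonal 3).over L))) ∧ Kf ≤ ((((standardMaximalCompactGL 3 L).comap (adelicVal (↥(maximalRealSubfield L)) L (IsCMField.complexConj L) 3 ((StdForm.antidiagonal 3).over L)) : Subgroup (quasiSplit (↥(maximalRealSubfield L)) L (IsCMField.complexConj L) 3).Adelic)).comap (finAdelicToAdelic (↥(maximalRealSubfield L)) L (IsCMField.complexConj L) 3 ((StdForm.antidiagonal 3).over L)) : Subgroup ↥(finAdelic (↥(maximalRealSubfield L)) L (IsCMField.complexConj L) 3 ((StdForm.antidiagonal 3).over L)))}) (x : X Kf),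
      ∃ b : β, (η₁ Kf x = χ₁ b ∧ η₂ Kf x = χ₂ b) ∨ (η₁ Kf x = reflectChar (IsCMField.complexConj L) (χ₁ b) ∧ η₂ Kf x = χ₂ b))
    (hassoc : ∀ (Kf : {Kf : Subgroup ↥(finAdelic (↥(maximalRealSubfield L)) L (IsCMField.complexConj L) 3 ((StdForm.antidiagonal 3).over L)) // IsOpen ((Kf : Subgroup ↥(finAdelic (↥(maximalRealSubfield L)) L (IsCMField.complexConj L) 3 ((StdForm.antidiagonal 3).over L))) : Set ↥(finAdelic (↥(maximalRealSubfield L)) L (IsCMField.complexConj L) 3 ((StdForm.antidiagonal 3).over L))) ∧ Kf ≤ ((((standardMaximalCompactGL 3 L).comap (adelicVal (↥(maximalRealSubfield L)) L (IsCMField.complexConj L) 3 ((StdForm.antidiagonal 3).over L)) : Subgroup (quasiSplit (↥(maximalRealSubfield L)) L (IsCMField.complexConj L) 3).Adelic)).comap (finAdelicToAdelic (↥(maximalRealSubfield L)) L (IsCMField.complexConj L) 3 ((StdForm.antidiagonal 3).over L)) : Subgroup ↥(finAdelic (↥(maximalRealSubfield L)) L (IsCMField.complexConj L) 3 ((StdForm.antidiagonal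 3).over L)))}) (b : β),
      resGBlock L μ (Kf.1.map (finAdelicToAdelic (↥(maximalRealSubfield L)) L (IsCMField.complexConj L) 3 ((StdForm.antidiagonal 3).over L))) 1 (reflectChar (IsCMField.complexConj L) (χ₁ b)) (χ₂ b) ≤ resGBlock L μ (Kf.1.map (finAdelicToAdelic (↥(maximalRealSubfield L)) L (IsCMField.complexConj L) 3 ((StdForm.antidiagonal 3).over L))) 1 (χ₁ b) (χ₂ b))
    (Kf : {Kf : Subgroup ↥(finAdelic (↥(maximalRealSubfield L)) L (IsCMField.complexConj L) 3 ((StdForm.antidiagonal 3).over L)) // IsOpen ((Kf : Subgroup ↥(finAdelic (↥(maximalRealSubfield L)) L (IsCMField.complexConj L) 3 ((StdForm.antidiagonal 3).over L))) : Set ↥(finAdelic (↥(maximalRealSubfield L)) L (IsCMField.complexConj L) 3 ((StdForm.antidiagonal 3).over L))) ∧ Kf ≤ ((((standardMaximalCompactGL 3 L).comap (adelicVal (↥(maximalRealSubfield L)) L (IsCMField.complexConj L) 3 ((StdForm.antidiagonal 3).over L)) : Subgroup (quasiSplit (↥(maximalRealSubfield L)) L (IsCMField.complexConj L) 3).Adelic)).comap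 (finAdelicToAdelic (↥(maximalRealSubfield L)) L (IsCMField.complexConj L) 3 ((StdForm.antidiagonal 3).over L)) : Subgroup ↥(finAdelic (↥(maximalRealSubfield L)) L (IsCMField.complexConj L) 3 ((StdForm.antidiagonal 3).over L)))}) :
    ((quasiSplit (↥(maximalRealSubfield L)) L (IsCMField.complexConj L) 3).cuspidalSubspace μ 𝔓).toSubmoduleᗮ ⊓ (⨅ u : ↥(Kf.1), Module.End.eigenspace ((((quasiSplit (↥(maximalRealSubfield L)) L (IsCMField.complexConj L) 3).rightRegular μ) (finAdelicToAdelic (↥(maximalRealSubfield L)) L (IsCMField.complexConj L) 3 ((StdForm.antidiagonal 3).over L) (u : ↥(finAdelic (↥(maximalRealSubfield L)) L (IsCMField.complexConj L) 3 ((StdForm.antidiagonal 3).over L)))) :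
        (quasiSplit (↥(maximalRealSubfield L)) L (IsCMField.complexConj L) 3).L2 μ →L[ℂ] (quasiSplit (↥(maximalRealSubfield L)) L (IsCMField.complexConj L) 3).L2 μ) : (quasiSplit (↥(maximalRealSubfield L)) L (IsCMField.complexConj L) 3).L2 μ →ₗ[ℂ] (quasiSplit (↥(maximalRealSubfield L)) L (IsCMField.complexConj L) 3).L2 μ) 1) ≤ (⨆ b, resGBlock L μ (Kf.1.map (finAdelicToAdelic (↥(maximalRealSubfield L)) L (IsCMField.complexConj L) 3 ((StdForm.antidiagonal 3).over L))) 1 (χ₁ b) (χ₂ b)).topologicalClosure :=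
  hHead_level_of_niceCoreAll_of_cover L μ 𝔓 hne h𝔓 χ₁ χ₂ η₁ η₂ hall (hcov_of_transversal L μ χ₁ χ₂ η₁ η₂ hmem hassoc) Kf

end Head

end Summit.HodgeConjecture.HodgeConjecture.R90.S8

end
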